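import Literature.MathematicalPhysics.QuantumFieldTheory.Balaban1983to89.B15Prop1GradientFromValue
import Literature.MathematicalPhysics.QuantumFieldTheory.Balaban1983to89.B15Prop1IntrinsicAtCoPRecord

/-!
# `Balaban1983to89.B15Prop1GradientFromValueAtCoPRecord` — [Balaban1989LargeFieldI] Prop. 1 p. 194 / [Balaban1989LargeFieldII] pp. 357–359: ★★★
# PROPOSITION 1 [IV] WITH ITS ANALYTIC-EXTENSION CLAUSE AT THE v1.5 BACKGROUND OF RECORD `Node00.bgMSCoPOfRecord F 2 ν K k Ω`, FROM (J1), (L2) AND THE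
# (1.77) VALUE LETTER (V) — the gradient letter (L3) of `B15Prop1IntrinsicAtCoPRecord` (p529759) REPLACED by an order-zero statement
# (`B15Prop1GradientFromValue.hJ_of_value`), the class invariance discharged by `B15Eq177ValueInvarianceCoDiv.gaugeAct_mem_regMSCoPOfRecord`

Honest framing: statement-level skeleton of published theorems with citation tags; proofs where landed; nothing here is a claim about
the Yang–Mills mass gap.

Cell pub-ymgap, HUMAN RULING D-0062 (Track A full width), seat `pub-ymgap-dag-n12-c` (R134 acceleration seat (a), strategy s1 of DAG node N12 = [B15];
generation g8).  This is the record-13-`CoP` twin of `B15Prop1GradientFromValue.…_ofRecord_ofValue`, exactly as `B15Prop1IntrinsicAtCoPRecord` (p529759) is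
the twin of `B15Prop1IntrinsicOfRecord` (p527900).

TYPING (instance hygiene — the reason this is its own module, as for p529759).  The NODE 00 record modules carry the global instance
`B6Prop26ReachTransplant.instDecidableEqPBond`, while the N12∕s1 chain states the slice objects over the CLASSICAL instance.  DEVICE (no attribute
touched, no instance declared): the bond-decidability is bound as an instance-implicit family `[hdec : ∀ j, DecidableEq (PBond (F.P K) j)]` with the
propositional pin `hcl : hdec = fun _ a b => Classical.propDecidable (a = b)` (a consumer discharges it by `Subsingleton.elim _ _`); the proof substitutes
`hcl` and applies `B15Prop1GradientFromValue.exists_domain_prop1Printed_lfVarOn_std_su2_box_intrinsic_analytic_ofRecord_ofValue` verbatim.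

WHAT THIS FILE PROVES (no `sorry`, no definition, no `… : Prop` fact; axioms standard): ★★★
`exists_domain_prop1Printed_lfVarOn_std_su2_box_intrinsic_analytic_atCoPRecord_ofValue` — `∃ a₁ > 0, B15.Prop1Printed (lfVarOn su2Chart fun i =>
InstOn.std (Node00.bgMSCoPOfRecord F 2 ν K k Ω) M₁ (Z i) (Λ i) (k i) (M i) (a₁ i) (anExt … (rA i)))` from (J1) `hGj`, (L2) `hlead` + `hsm`∕`hγle`, (V) `hV`
(the value `A(U_{k,Z}(ext V_k)) ≤ cA·ε²` at `ε`-regular data) + the bookkeeping `hcJ'`, `hk`, structure, and the instance pin `hcl`.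

HONEST SCOPE.  Count-neutral; (J1)∕(L2) are NODE 00's ([15] Thm 1 ∕ Prop. 9; [IV] p. 193; [LF-II] pp. 357–359) and (V) is NODE 00's regularity of
`U_{k,Z}` on its component ([IV] p. 193 ll. 17–20, [15] Thm 1 (8) p. 279) summed over the component's plaquettes — NOT proved here; the locality trade
against print's `B₃²4ε_k` is stated in `B15Prop1GradientFromValue`; NOT a discharge of N12; nothing continuum ∕ OS ∕ mass-gap ∕ Clay.
-/

noncomputable section

open Set Finset Metric
open scoped BigOperators Matrix RealInnerProductSpace Real InnerProductSpace

namespace Literature.MathematicalPhysics.QuantumFieldTheory.Balaban1983to89.B15Prop1GradientFromValueAtCoPRecord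

open B15DeterminingSets GaugeField B16Sect1Backgrounds B15Prop1Carrier B8Eq17ClassAkV1
open B15Prop1SliceTaylorCalculus B15Prop1LocalLettersOfFun B15Prop1IntrinsicOfFun B15Prop1IntrinsicOfRecord B15Prop1GradientFromValue
open B15Prop1AnalyticExtClause (cplxVec cplxSlice anExt)
open B15Prop1ChartCalculusSU2 (E3)
open T4CubeChartGnomonic (SU2)
open B15Prop1ChartSU2 (su2Chart)
open B15Prop1SliceCoordinates (GaugeSlice ιA freeBonds)
open T4AxialGaugeSmallField (castSite boxPlaqs)
open B6BondElimination (unitVec)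
open B16Eq18Proof (box)
open B15Extension193 (extend)
open B15ShellGauge193 (shellGauge)
open B5Bounds167Lattice (formDk ofRealCfg)
open B14.Eq213DetSet B14.Eq216Concrete B15Sect1Instances B15Eq177GaugeInvariance B15Eq177ValueInvariance B15Eq177ValueInvarianceCoDiv
open Literature.MathematicalPhysics.QuantumFieldTheory.BalabanImbrieJaffe1984to88.BIJ85Eq453GaugeField
open T4Continuum

section Record

open Classical

/-- ★★★ **PROPOSITION 1 [IV] WITH ITS ANALYTIC-EXTENSION CLAUSE AT THE v1.5 BACKGROUND OF RECORD `bgMSCoPOfRecord F 2 ν K k Ω`, WITH THE GRADIENT LETTER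
(L3) REPLACED BY THE (1.77) VALUE LETTER (V)** (`SU(2)`; the class `regMSCoPOfRecord` = [15] (2) = [6] (1.7) ∧ (1.9) on the support of record): the record
corollary `B15Prop1GradientFromValue.exists_domain_prop1Printed_lfVarOn_std_su2_box_intrinsic_analytic_ofRecord_ofValue` with the class invariance
DISCHARGED (`B15Eq177ValueInvarianceCoDiv.gaugeAct_mem_regMSCoPOfRecord`, [15] p. 278 «the spaces … are invariant»).  WHAT A CONSUMER SUPPLIES: (J1) `hGj`,
(L2) `hlead` + `hsm`∕`hγle`, (V) `hV : A(U_{k,Z}(ext V_k)) ≤ cA·ε²` at `ε`-regular data + `hcJ' : 2cA·eR∕R + 2𝓐∕(R·eR) ≤ cJ`, `k i ≤ m + K`, the structural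
box∕margin∕constant hypotheses and the instance pin `hcl := Subsingleton.elim _ _` — nothing else. [cite: Balaban1989LargeFieldI, Prop. 1 (1.77)–(1.78)
p.194 (incl. the last clause), p.193, (1.74) p.192; Balaban1989LargeFieldII, (1.7)–(1.9) p.358, (1.11) p.358, (1.12)–(1.13) p.359; Balaban1985Variational,
(2) p.278, Thm 1 (8) p.279, Prop. 9 p.309] -/
theorem exists_domain_prop1Printed_lfVarOn_std_su2_box_intrinsic_analytic_atCoPRecord_ofValue {F : T4Family} (ν : Node00.Stage7Numerics)
    (Kt kr : ℕ) (Ω : ℕ → Set (Site (F.P Kt) 0)) (hd3 : 3 ≤ (F.P Kt).d) (h0 : 0 < (F.P Kt).d) {ι : Type}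
    -- bond decidability: the consumer's instance, pinned propositionally to the chain's classical one (`hcl := Subsingleton.elim _ _`)
    [hdec : ∀ j, DecidableEq (PBond (F.P Kt) j)] (hcl : hdec = fun _ a b => Classical.propDecidable (a = b))
    (M₁ : ℕ) (Z Λ : ι → Set (Site (F.P Kt) 0)) (k : ι → ℕ) (M : ι → ℝ) (hk : ∀ i, k i ≤ (F.P Kt).m + (F.P Kt).K)
    (eR : ι → ℝ) (heR : ∀ i, 0 < eR i)
    (T : ∀ i, Finset (PBond (F.P Kt) (k i)))
    (lo hi : ι → Fin (F.P Kt).d → ℤ) (n : ι → ℕ) (hn : ∀ i κ, hi i κ ≤ lo i κ + n i) (hN : ∀ i, n i + 2 < (F.P Kt).sitesPerDir (k i))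
    (hbox : ∀ i, pts (k i) (Λ i) = (castSite '' Set.Icc (lo i) (hi i) : Set (Site (F.P Kt) (k i))))
    (hZ : ∀ i, (boxPlaqs (lo i - 1) (hi i + 1) : Set (Plaq (F.P Kt) (k i))) ⊆ plaqsInside (pts (k i) (Z i)))
    (hTG0 : ∀ i, T i = (box (fun κ => (hi i κ - lo i κ + 1).toNat) (lo i)).image fun x =>
      (⟨castSite (x - unitVec ⟨0, h0⟩), ⟨0, h0⟩⟩ : PBond (F.P Kt) (k i)))
    (hN5 : ∀ i κ, ((hi i κ - lo i κ + 1).toNat : ℤ) + 5 < (F.P Kt).sitesPerDir (k i))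
    (K : ι → ℕ) (hK1 : ∀ i, 1 ≤ K i) (hKn : ∀ i κ, (hi i κ - lo i κ + 1).toNat ≤ K i)
    (ext : ∀ i, GaugeField (F.P Kt) (k i) SU2 → GaugeField (F.P Kt) (k i) SU2)
    (hext : ∀ i Vk, ext i Vk = extend (pts (k i) (Λ i)) (shellGauge Vk (lo i) (hi i)) Vk)
    (hlohi : ∀ i, lo i ≤ hi i)
    {γ cJ bx : ℝ} (hγ : 0 < γ) (hcJ : 0 ≤ cJ) (hbx : 0 ≤ bx)
    (hbxM : ∀ i, 12 * ((F.P Kt).d : ℝ) * ((n i : ℝ) + 2) ^ 2 ≤ bx * (M i) ^ 2)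
    {Cerr R 𝓐 : ι → ℝ} (hM : ∀ i, 1 ≤ (M i)) (hR : ∀ i, 0 < R i) (h𝓐 : ∀ i, 0 ≤ 𝓐 i)
    (n' : ι → ℕ) (hn' : ∀ i, 1 ≤ n' i)
    -- (J1) the JOINT holomorphic extension of print's function in the datum perturbation and the field
    (hGj : ∀ i Vk, PlaqSmallOn (plaqsInside (pts (k i) (Z i ∩ (Λ i)ᶜ))) (eR i) Vk →
      ∃ 𝒢 : VecField (F.P Kt) (k i) (EuclideanSpace ℂ (Fin 3)) × VecField (F.P Kt) (k i) (EuclideanSpace ℂ (Fin 3)) → ℂ,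
        DifferentiableOn ℂ 𝒢 (ball 0 (R i)) ∧
        (∀ z ∈ ball (0 : VecField (F.P Kt) (k i) (EuclideanSpace ℂ (Fin 3)) × VecField (F.P Kt) (k i) (EuclideanSpace ℂ (Fin 3))) (R i), ‖𝒢 z‖ ≤ 𝓐 i) ∧
        ∀ p B' : VecField (F.P Kt) (k i) E3, ‖p‖ < R i → ‖B'‖ < R i →
          𝒢 (cplxVec p, cplxVec B') =
            ((fun177std (Node00.bgMSCoPOfRecord F 2 ν Kt kr Ω) M₁ (Z i) (k i) (expMul su2Chart B' (ext i (expMul su2Chart p Vk))) : ℝ) : ℂ))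
    -- (L2) (1.7)–(1.9) p.358 for the Hessian of the slice function at `0`
    (hlead : ∀ i Vk, PlaqSmallOn (plaqsInside (pts (k i) (Z i ∩ (Λ i)ᶜ))) (eR i) Vk →
      ∀ X : GaugeSlice (pts (k i) (Λ i)) (T i) E3,
      |⟪X, (fderiv ℝ (rGrad (pts (k i) (Λ i)) (T i)
              (sliceFn (pts (k i) (Λ i)) (T i) (fun177std (Node00.bgMSCoPOfRecord F 2 ν Kt kr Ω) M₁ (Z i) (k i)) (ext i Vk))) 0) X⟫ -
          ∑ a : Fin 3, formDk (n' i) (fun _ : Fin (F.P Kt).d => (F.P Kt).sitesPerDir (k i))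
            (ofRealCfg (fun _ : Fin (F.P Kt).d => (F.P Kt).sitesPerDir (k i)) fun j =>
              ιA (pts (k i) (Λ i)) (T i) X ⟨j.1, j.2⟩ a)| ≤ Cerr i * ‖X‖ ^ 2)
    (hsm : ∀ i, Cerr i ≤ (4 / Real.pi ^ 2) ^ ((F.P Kt).d + 2) / (2 * (3 * (K i : ℝ) ^ 2 + 2 * (K i : ℝ) ^ 4)))
    (hγle : ∀ i, γ / (M i) ^ 5 ≤ (4 / Real.pi ^ 2) ^ ((F.P Kt).d + 2) / (2 * (3 * (K i : ℝ) ^ 2 + 2 * (K i : ℝ) ^ 4)))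
    -- (V) the VALUE of (1.77) at the extended regular datum is small (replaces (L3))
    {cA : ℝ}
    (hV : ∀ i ε Vk, 0 < ε → ε ≤ eR i → PlaqSmallOn (plaqsInside (pts (k i) (Z i ∩ (Λ i)ᶜ))) ε Vk →
      fun177std (Node00.bgMSCoPOfRecord F 2 ν Kt kr Ω) M₁ (Z i) (k i) (ext i Vk) ≤ cA * ε ^ 2)
    (hcJ' : ∀ i, 2 * cA * eR i / R i + 2 * 𝓐 i / (R i * eR i) ≤ cJ)
    : ∃ a₁ : ι → ℝ, (∀ i, 0 < a₁ i) ∧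
      B15.Prop1Printed (lfVarOn su2Chart fun i => InstOn.std (Node00.bgMSCoPOfRecord F 2 ν Kt kr Ω) M₁ (Z i) (Λ i) (k i) (M i) (a₁ i)
        (anExt (pts (k i) (Λ i)) (T i) (fun177std (Node00.bgMSCoPOfRecord F 2 ν Kt kr Ω) M₁ (Z i) (k i)) (ext i)
          (min (1 / 2) (min (R i / 8) (γ / (M i) ^ 5 * (R i / 2) ^ 2 / (48 * (4 * 𝓐 i / R i + 1))))))) := by
  subst hcl
  exact exists_domain_prop1Printed_lfVarOn_std_su2_box_intrinsic_analytic_ofRecord_ofValue hd3 h0 (Node00.avOfRecord F 2 Kt)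
    (gaugeAct_mem_regMSCoPOfRecord ν Kt kr Ω) M₁ Z Λ k M hk eR heR T lo hi n hn hN hbox hZ hTG0 hN5 K hK1 hKn ext hext hlohi hγ hcJ hbx
    hbxM hM hR h𝓐 n' hn' hGj hlead hsm hγle hV hcJ'

end Record

end Literature.MathematicalPhysics.QuantumFieldTheory.Balaban1983to89.B15Prop1GradientFromValueAtCoPRecord

end
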